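import Mathlib

/-!
# Load-bearing hypotheses of `stub_circuitCore` — drefute seat, line `valuation-kernel-sweep`
(crux stmt-KontsevichZagierPeriods-3469, lead skeleton r1 of 2026-08-16T00:08:16Z)

`CircuitCoreWith u₁ u₂ u₃` is the lead's abstract circuit stub `stub_circuitCore` VERBATIM, with its
three hypotheses made switchable:
* H1 `∃ j, 0 < (-1)^j * D j` and H2 `∃ j, (-1)^j * D j < 0` (the circuit has coefficients of both
  signs — for the lifted configuration this is acyclicity),
* H3 `∀ j a, D j ≠ 0 → D (j.succAbove a) ≠ 0 → E j a ≠ 0` (the test vector `Q` is off every wall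
  spanned by three of the vectors, whenever both omitted vectors have non-degenerate cones).

`CircuitCoreWith true true true` is literally the stub. We show that EACH hypothesis is necessary
(`circuitCore_false_without_H1/_H2/_H3`) by explicit integer witnesses — so any proof of the stub must
use all three; and the exact-arithmetic search (kit job j007720, 9.6·10⁵ configurations incl. all
degenerate strata) found no counterexample to the stub itself.

Witnesses (all determinants are of 0/±1-type integer matrices, evaluated by cofactor expansion):
* H2 dropped: `v = (e₀,e₁,e₂,e₃,−e₀)`, `Q = (1,1,1,1)`: `D = (1,0,0,0,1)`, `Q` lies in the open cone
  omitting `v₄` only; signed count `= 1`.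
* H1 dropped: the mirror image `v = (e₁,e₀,e₂,e₃,−e₁)`, same `Q`: `D = (−1,0,0,0,−1)`, count `= −1`.
* H3 dropped: the bipyramid `N=(1,1,1,1), S=(0,0,0,1), A=(1,0,0,1), B=(0,1,0,1), C=(0,0,1,1)` with
  `Q = (3,2,1,6)` ON the common face `ABC` of the two-cell triangulation but INSIDE the cell `NSAB`
  of the three-cell one: `D = (−1,2,1,−1,1)`, count `= 1`.
-/

open Matrix Finset

namespace DrefuteCircuit

/-- `stub_circuitCore` with switchable hypotheses; `CircuitCoreWith true true true` is the stub. -/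
def CircuitCoreWith (useH1 useH2 useH3 : Bool) : Prop :=
  ∀ (v : Fin 5 → Fin 4 → ℝ) (Q : Fin 4 → ℝ) (D : Fin 5 → ℝ) (E : Fin 5 → Fin 4 → ℝ),
    (∀ j, D j = (Matrix.of fun a b => v (j.succAbove a) b).det) →
    (∀ j a, E j a = ((Matrix.of fun a' b => v (j.succAbove a') b).updateRow a Q).det) →
    (useH1 = true → ∃ j : Fin 5, 0 < (-1 : ℝ) ^ (j : ℕ) * D j) →
    (useH2 = true → ∃ j : Fin 5, (-1 : ℝ) ^ (j : ℕ) * D j < 0) →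
    (useH3 = true → ∀ j a, D j ≠ 0 → D (j.succAbove a) ≠ 0 → E j a ≠ 0) →
    ∑ j : Fin 5, (-1 : ℝ) ^ (j : ℕ) * Real.sign (D j) *
      (if ∀ a, 0 < D j * E j a then (1 : ℝ) else 0) = 0

/-! ### Witness A: H2 is necessary -/

def vA : Fin 5 → Fin 4 → ℝ :=
  ![![1, 0, 0, 0], ![0, 1, 0, 0], ![0, 0, 1, 0], ![0, 0, 0, 1], ![-1, 0, 0, 0]]
def QA : Fin 4 → ℝ := ![1, 1, 1, 1]
def DA : Fin 5 → ℝ := ![1, 0, 0, 0, 1]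
def EA : Fin 5 → Fin 4 → ℝ :=
  ![![1, 1, 1, -1], ![1, 0, 0, 1], ![-1, 0, 0, -1], ![1, 0, 0, 1], ![1, 1, 1, 1]]

theorem dA (j : Fin 5) : DA j = (Matrix.of fun a b => vA (j.succAbove a) b).det := by
  fin_cases j <;>
    (rw [Matrix.det_succ_row_zero]
     simp [Fin.sum_univ_succ, Matrix.det_fin_three, Matrix.submatrix_apply, Fin.succAbove, vA, DA])

theorem eA (j : Fin 5) (a : Fin 4) :
    EA j a = ((Matrix.of fun a' b => vA (j.succAbove a') b).updateRow a QA).det := by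
  fin_cases j <;> fin_cases a <;>
    (rw [Matrix.det_succ_row_zero]
     simp [Fin.sum_univ_succ, Matrix.det_fin_three, Matrix.submatrix_apply, Fin.succAbove, vA, QA,
       EA, Matrix.updateRow_apply, pow_succ])

theorem circuitCore_false_without_H2 : ¬ CircuitCoreWith true false true := by
  intro h
  have h' := h vA QA DA EA dA eA
    (fun _ => ⟨0, by simp [DA]⟩) (fun h0 => Bool.noConfusion h0)
    (fun _ j a => by
      fin_cases j <;> fin_cases a <;> simp [DA, EA, Fin.succAbove])
  have hs : ∑ j : Fin 5, (-1 : ℝ) ^ (j : ℕ) * Real.sign (DA j) *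
      (if ∀ a, 0 < DA j * EA j a then (1 : ℝ) else 0) = 1 := by
    simp [Fin.sum_univ_five, DA, EA, Fin.forall_fin_succ, Real.sign_one]
    norm_num
  rw [hs] at h'
  exact one_ne_zero h'

/-! ### Witness B: H1 is necessary (mirror image of A) -/

def vB : Fin 5 → Fin 4 → ℝ :=
  ![![0, 1, 0, 0], ![1, 0, 0, 0], ![0, 0, 1, 0], ![0, 0, 0, 1], ![0, -1, 0, 0]]
def DB : Fin 5 → ℝ := ![-1, 0, 0, 0, -1]
def EB : Fin 5 → Fin 4 → ℝ :=
  ![![-1, -1, -1, 1], ![-1, 0, 0, -1], ![1, 0, 0, 1], ![-1, 0, 0, -1], ![-1, -1, -1, -1]]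

theorem dB (j : Fin 5) : DB j = (Matrix.of fun a b => vB (j.succAbove a) b).det := by
  fin_cases j <;>
    (rw [Matrix.det_succ_row_zero]
     simp [Fin.sum_univ_succ, Matrix.det_fin_three, Matrix.submatrix_apply, Fin.succAbove, vB, DB])

theorem eB (j : Fin 5) (a : Fin 4) :
    EB j a = ((Matrix.of fun a' b => vB (j.succAbove a') b).updateRow a QA).det := by
  fin_cases j <;> fin_cases a <;>
    (rw [Matrix.det_succ_row_zero]
     simp [Fin.sum_univ_succ, Matrix.det_fin_three, Matrix.submatrix_apply, Fin.succAbove, vB, QA,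
       EB, Matrix.updateRow_apply, pow_succ])

theorem circuitCore_false_without_H1 : ¬ CircuitCoreWith false true true := by
  intro h
  have h' := h vB QA DB EB dB eB
    (fun h0 => Bool.noConfusion h0) (fun _ => ⟨0, by simp [DB]⟩)
    (fun _ j a => by
      fin_cases j <;> fin_cases a <;> simp [DB, EB, Fin.succAbove])
  have hs : ∑ j : Fin 5, (-1 : ℝ) ^ (j : ℕ) * Real.sign (DB j) *
      (if ∀ a, 0 < DB j * EB j a then (1 : ℝ) else 0) = -1 := by
    simp [Fin.sum_univ_five, DB, EB, Fin.forall_fin_succ, Real.sign_neg, Real.sign_one]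
    norm_num
  rw [hs] at h'
  norm_num at h'

/-! ### Witness C: H3 is necessary (bipyramid, `Q` on the face `ABC`) -/

def vC : Fin 5 → Fin 4 → ℝ :=
  ![![1, 1, 1, 1], ![0, 0, 0, 1], ![1, 0, 0, 1], ![0, 1, 0, 1], ![0, 0, 1, 1]]
def QC : Fin 4 → ℝ := ![3, 2, 1, 6]
def DC : Fin 5 → ℝ := ![-1, 2, 1, -1, 1]
def EC : Fin 5 → Fin 4 → ℝ :=
  ![![0, -3, -2, -1], ![0, 6, 4, 2], ![3, 6, -1, -2], ![-2, -4, -1, 1], ![1, 2, 2, 1]]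

theorem dC (j : Fin 5) : DC j = (Matrix.of fun a b => vC (j.succAbove a) b).det := by
  fin_cases j <;>
    (rw [Matrix.det_succ_row_zero]
     simp [Fin.sum_univ_succ, Matrix.det_fin_three, Matrix.submatrix_apply, Fin.succAbove, vC, DC]) <;>
    norm_num

theorem eC (j : Fin 5) (a : Fin 4) :
    EC j a = ((Matrix.of fun a' b => vC (j.succAbove a') b).updateRow a QC).det := by
  fin_cases j <;> fin_cases a <;>
    (rw [Matrix.det_succ_row_zero]
     simp [Fin.sum_univ_succ, Matrix.det_fin_three, Matrix.submatrix_apply, Fin.succAbove, vC, QC,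
       EC, Matrix.updateRow_apply, pow_succ]) <;>
    norm_num

theorem circuitCore_false_without_H3 : ¬ CircuitCoreWith true true false := by
  intro h
  have h' := h vC QC DC EC dC eC
    (fun _ => ⟨2, by simp [DC]⟩) (fun _ => ⟨0, by simp [DC]⟩) (fun h0 => Bool.noConfusion h0)
  have hs : ∑ j : Fin 5, (-1 : ℝ) ^ (j : ℕ) * Real.sign (DC j) *
      (if ∀ a, 0 < DC j * EC j a then (1 : ℝ) else 0) = 1 := by
    simp [Fin.sum_univ_five, DC, EC, Fin.forall_fin_succ, Real.sign_neg, Real.sign_one]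
    norm_num
  rw [hs] at h'
  exact one_ne_zero h'

/-! ### The link with the registered stub -/

/-- `CircuitCoreWith true true true` implies the registered `stub_circuitCore` verbatim (and
conversely; both directions are re-bracketing of hypotheses). -/
theorem stub_of_circuitCoreWith (h : CircuitCoreWith true true true) :
    ∀ (v : Fin 5 → Fin 4 → ℝ) (Q : Fin 4 → ℝ) (D : Fin 5 → ℝ) (E : Fin 5 → Fin 4 → ℝ), (∀ j, D j = (Matrix.of fun a b => v (j.succAbove a) b).det) → (∀ j a, E j a = ((Matrix.of fun a' b => v (j.succAbove a') b).updateRow a Q).det) → (∃ j : Fin 5, 0 < (-1 : ℝ) ^ (j : ℕ) * D j) → (∃ j : Fin 5, (-1 : ℝ) ^ (j : ℕ) * D j < 0) → (∀ j a, D j ≠ 0 → D (j.succAbove a) ≠ 0 → E j a ≠ 0) → ∑ j : Fin 5, (-1 : ℝ) ^ (j : ℕ) * Real.sign (D j) * (if ∀ a, 0 < D j * E j a then (1 : ℝ) else 0) = 0 :=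
  fun v Q D E hD hE h1 h2 h3 => h v Q D E hD hE (fun _ => h1) (fun _ => h2) (fun _ => h3)

theorem circuitCoreWith_of_stub
    (h : ∀ (v : Fin 5 → Fin 4 → ℝ) (Q : Fin 4 → ℝ) (D : Fin 5 → ℝ) (E : Fin 5 → Fin 4 → ℝ), (∀ j, D j = (Matrix.of fun a b => v (j.succAbove a) b).det) → (∀ j a, E j a = ((Matrix.of fun a' b => v (j.succAbove a') b).updateRow a Q).det) → (∃ j : Fin 5, 0 < (-1 : ℝ) ^ (j : ℕ) * D j) → (∃ j : Fin 5, (-1 : ℝ) ^ (j : ℕ) * D j < 0) → (∀ j a, D j ≠ 0 → D (j.succAbove a) ≠ 0 → E j a ≠ 0) → ∑ j : Fin 5, (-1 : ℝ) ^ (j : ℕ) * Real.sign (D j) * (if ∀ a, 0 < D j * E j a then (1 : ℝ) else 0) = 0) :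
    CircuitCoreWith true true true :=
  fun v Q D E hD hE h1 h2 h3 => h v Q D E hD hE (h1 rfl) (h2 rfl) (h3 rfl)

end DrefuteCircuit
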